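import Mathlib.Data.Nat.Choose.Basic
import Mathlib.Algebra.BigOperators.Intervals
import Mathlib.Algebra.Order.BigOperators.Group.Finset
import Mathlib.Tactic
import Summits.CriticalPhenomena.PercolationContinuityZ3.Theorems.PercNearOneGluingNoHeavyLowerTailCoreRho
import HarnessLib

/-!
# CORE(t) for every t: the biased CORE LEMMA (hit-set form) at every bias

Support file for the Sahi / Conjecture-P programme of route `PercNearOneGluingNoHeavy`
(`--supports stmt-CriticalPhenomena-4575`, prover prim-l12-p5 gen 28; proof notes
`prim-l12-p5/OMEGA1-g27.md` §1–§2, §5 and `prim-l12-p5/U-PROOF-g28.md` §8).  No definitions, no named facts,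
no sorries.

OMEGA1-g27 §1 reduces (Ω₁) at every real rate `θ > 0` to CORE(t) for all `t ∈ (0,1)`: with `ρ = t/(1-t)` and the
symmetrised biased buffer `B_ρ(i) = C(h-2, i-1)·(ρ^i + ρ^{h-i})` (`h = h₁+h₂`; `K_t(i) = (1-t)^h B_ρ(i)`, so `D_t = (1-t)^h·D_ρ`), blocks
`n_b = h_b + u_b = 2m_b - 1` (`m₁ = a+1`, `m₂ = c+1`) and `S_ρ(α,γ) = ∑_{i,j} C(h₁,i)C(u₁,α-i)C(h₂,j)C(u₂,γ-j)B_ρ(i+j)`: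
`CORE(t):  (a+c)·S_ρ(a+1,c) ≤ (a+c+1)·S_ρ(a+1,c+1)`  (`ρ = 1`: the CORE LEMMA `CoreLemma.core_lemma` at `s = 0`).

* `reindex_block` : per-block change of variables hits drawn `i` ↔ unhits drawn `x = m - i`;
* `core_t` (**CORE(t) for every `ρ > 0`**, `h₁ + h₂ ≥ 2`): by the MASTER IDENTITY (`CoreMaster.master_abstract`,
  valid for every reflection-symmetric buffer) `4(u₁+1)(u₂+1)·[(a+c+1)S_ρ(a+1,c+1) - (a+c)S_ρ(a+1,c)]` is the
  `W`-sum `∑ C(h₁,i)C(u₁+1,a+1-i)C(h₂,j)C(u₂+1,c+1-j)B_ρ(i+j)[(u₁+1)(u₂+1) + (2a+2c+1)(2i-h₁)(2j-h₂)]`, which in the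
  unhit coordinates is `ρ·[Σ(ρ) + ρ^L Σ(1/ρ)]` with `Σ(σ)` the block-form sum of `CoreRho.core_rho_pos`
  (`M_b = u_b+1`, `w_b(x) = C(h_b,m_b-x)`, `L = h-2`, `K = a+c+1`), hence nonnegative.
What is left for (Ω₁) ∀θ in Lean is only the Beta-integral mixture of OMEGA1-g27 §1.
-/

namespace Summit.CriticalPhenomena.PercolationContinuityZ3.Theorems

namespace CoreT

open Finset

/-- Per-block change of variables `x = m - i`:
`∑_i C(h,i)·C(M,m-i)[i ≤ m]·Φ(i) = ∑_x C(M,x)·C(h,m-x)[x ≤ m]·Φ(m-x)`. -/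
theorem reindex_block (h m M : ℕ) (Φ : ℕ → ℝ) :
    ∑ i ∈ range (h + 1), (h.choose i : ℝ) * (if i ≤ m then (M.choose (m - i) : ℝ) else 0) * Φ i =
      ∑ x ∈ range (M + 1), (M.choose x : ℝ) * (if x ≤ m then (h.choose (m - x) : ℝ) else 0) * Φ (m - x) := by
  apply Finset.sum_bij_ne_zero (fun i _ _ => m - i)
  · intro i hi hne
    have him : i ≤ m := by
      by_contra hc
      rw [if_neg hc] at hne
      simp at hne
    rw [if_pos him] at hne
    have : m - i ≤ M := by
      by_contra hc
      push Not at hc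
      rw [Nat.choose_eq_zero_of_lt hc] at hne
      simp at hne
    exact mem_range.mpr (by omega)
  · intro i₁ hi₁ hne₁ i₂ hi₂ hne₂ heq
    have h1 : i₁ ≤ m := by
      by_contra hc
      rw [if_neg hc] at hne₁
      simp at hne₁
    have h2 : i₂ ≤ m := by
      by_contra hc
      rw [if_neg hc] at hne₂
      simp at hne₂
    have heq' : m - i₁ = m - i₂ := heq
    omega
  · intro x hx hne
    have hxm : x ≤ m := by
      by_contra hc
      rw [if_neg hc] at hne
      simp at hne
    rw [if_pos hxm] at hne
    have hxh : m - x ≤ h := by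
      by_contra hc
      push Not at hc
      rw [Nat.choose_eq_zero_of_lt hc] at hne
      simp at hne
    refine ⟨m - x, mem_range.mpr (by omega), ?_, Nat.sub_sub_self hxm⟩
    rw [if_pos (show m - x ≤ m by omega), Nat.sub_sub_self hxm]
    intro hc
    apply hne
    have hx' : x ≤ M := by have := mem_range.mp hx; omega
    -- C(h,m-x) C(M,x) Φ(m-x) = 0
    linarith [hc]
  · intro i hi hne
    have him : i ≤ m := by
      by_contra hc
      rw [if_neg hc] at hne
      simp at hne
    show (h.choose i : ℝ) * (if i ≤ m then (M.choose (m - i) : ℝ) else 0) * Φ i =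
      (M.choose (m - i) : ℝ) * (if m - i ≤ m then (h.choose (m - (m - i)) : ℝ) else 0) * Φ (m - (m - i))
    rw [if_pos him, if_pos (show m - i ≤ m by omega), Nat.sub_sub_self him]
    ring

/-- **CORE(t) for every bias** (`ρ = t/(1-t) > 0`).  For block sizes `h_b + u_b = 2m_b - 1` (`m₁ = a+1`,
`m₂ = c+1`), `h₁ + h₂ ≥ 2`, and the symmetrised biased buffer
`B_ρ(i) = C(h₁+h₂-2, i-1)(ρ^i + ρ^{h₁+h₂-i})` (`0` for `i = 0`):
`(a+c)·S_ρ(a+1,c) ≤ (a+c+1)·S_ρ(a+1,c+1)`. -/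
theorem core_t (a c h₁ u₁ h₂ u₂ : ℕ) (hn₁ : h₁ + u₁ = 2 * a + 1) (hn₂ : h₂ + u₂ = 2 * c + 1)
    (hh : 2 ≤ h₁ + h₂) (ρ : ℝ) (hρ : 0 < ρ) :
    ((a : ℝ) + c) * ∑ i ∈ range (h₁ + 1), ∑ j ∈ range (h₂ + 1),
        (h₁.choose i : ℝ) * (if i ≤ a + 1 then (u₁.choose (a + 1 - i) : ℝ) else 0) *
          ((h₂.choose j : ℝ) * (if j ≤ c then (u₂.choose (c - j) : ℝ) else 0)) *
          ((if 1 ≤ i + j then ((h₁ + h₂ - 2).choose (i + j - 1) : ℝ) else 0) *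
            (ρ ^ (i + j) + ρ ^ (h₁ + h₂ - (i + j)))) ≤
    ((a : ℝ) + c + 1) * ∑ i ∈ range (h₁ + 1), ∑ j ∈ range (h₂ + 1),
        (h₁.choose i : ℝ) * (if i ≤ a + 1 then (u₁.choose (a + 1 - i) : ℝ) else 0) *
          ((h₂.choose j : ℝ) * (if j ≤ c + 1 then (u₂.choose (c + 1 - j) : ℝ) else 0)) *
          ((if 1 ≤ i + j then ((h₁ + h₂ - 2).choose (i + j - 1) : ℝ) else 0) *
            (ρ ^ (i + j) + ρ ^ (h₁ + h₂ - (i + j)))) := by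
  have hρne : ρ ≠ 0 := hρ.ne'
  -- the buffer is reflection-symmetric
  set B : ℕ → ℝ := fun i => (if 1 ≤ i then ((h₁ + h₂ - 2).choose (i - 1) : ℝ) else 0) *
    (ρ ^ i + ρ ^ (h₁ + h₂ - i)) with hBdef
  have hB : ∀ i ≤ h₁ + h₂, B (h₁ + h₂ - i) = B i := by
    intro i hi
    show (if 1 ≤ h₁ + h₂ - i then ((h₁ + h₂ - 2).choose (h₁ + h₂ - i - 1) : ℝ) else 0) *
        (ρ ^ (h₁ + h₂ - i) + ρ ^ (h₁ + h₂ - (h₁ + h₂ - i))) =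
      (if 1 ≤ i then ((h₁ + h₂ - 2).choose (i - 1) : ℝ) else 0) * (ρ ^ i + ρ ^ (h₁ + h₂ - i))
    rw [show h₁ + h₂ - (h₁ + h₂ - i) = i by omega, add_comm (ρ ^ (h₁ + h₂ - i))]
    congr 1
    by_cases g1 : 1 ≤ i
    · rw [if_pos g1]
      by_cases g2 : 1 ≤ h₁ + h₂ - i
      · rw [if_pos g2, show h₁ + h₂ - i - 1 = (h₁ + h₂ - 2) - (i - 1) by omega, Nat.choose_symm (by omega)]
      · rw [if_neg g2, Nat.choose_eq_zero_of_lt (by omega)]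
        simp
    · rw [if_neg g1]
      have hi0 : i = 0 := by omega
      subst hi0
      by_cases g2 : 1 ≤ h₁ + h₂ - 0
      · rw [if_pos g2, Nat.choose_eq_zero_of_lt (by omega)]
        simp
      · rw [if_neg g2]
  -- the MASTER IDENTITY
  have hM := CoreMaster.master_abstract h₁ h₂ (fun i => (h₁.choose i : ℝ)) (fun j => (h₂.choose j : ℝ))
    (fun i => if i ≤ a + 1 then (u₁.choose (a + 1 - i) : ℝ) else 0)
    (fun i => if i ≤ a then (u₁.choose (a - i) : ℝ) else 0)
    (fun i => if i ≤ a + 1 then ((u₁ + 1).choose (a + 1 - i) : ℝ) else 0)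
    (fun j => if j ≤ c + 1 then (u₂.choose (c + 1 - j) : ℝ) else 0)
    (fun j => if j ≤ c then (u₂.choose (c - j) : ℝ) else 0)
    (fun j => if j ≤ c + 1 then ((u₂ + 1).choose (c + 1 - j) : ℝ) else 0)
    B ((u₁ : ℝ) + 1) ((u₂ : ℝ) + 1) ((a : ℝ) + c)
    (fun i hi => CoreMaster.eta_reflect h₁ i hi) (fun j hj => CoreMaster.eta_reflect h₂ j hj) hB
    (fun i hi => CoreMaster.p_reflect a h₁ u₁ i hn₁ hi) (fun i hi => CoreMaster.P_reflect a h₁ u₁ i hn₁ hi)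
    (fun j hj => CoreMaster.p_reflect c h₂ u₂ j hn₂ hj) (fun j hj => CoreMaster.P_reflect c h₂ u₂ j hn₂ hj)
    (fun i hi => CoreMaster.R2 a h₁ u₁ i ((a : ℝ) + c) hn₁ hi)
    (fun j _ => CoreMaster.R3 c h₂ u₂ j hn₂)
  -- it suffices that the W-sum (the right-hand side of the MASTER IDENTITY) is nonnegative
  suffices hW : 0 ≤ ∑ i ∈ range (h₁ + 1), ∑ j ∈ range (h₂ + 1),
      (h₁.choose i : ℝ) * (if i ≤ a + 1 then ((u₁ + 1).choose (a + 1 - i) : ℝ) else 0) *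
        ((h₂.choose j : ℝ) * (if j ≤ c + 1 then ((u₂ + 1).choose (c + 1 - j) : ℝ) else 0)) * B (i + j) *
        (((u₁ : ℝ) + 1) * ((u₂ : ℝ) + 1) + (2 * ((a : ℝ) + c) + 1) * ((2 * (i : ℝ) - h₁) * (2 * (j : ℝ) - h₂))) by
    rw [← hM] at hW
    have hpos : (0 : ℝ) < 4 * ((u₁ : ℝ) + 1) * ((u₂ : ℝ) + 1) := by positivity
    have := nonneg_of_mul_nonneg_right (by linarith [hW] : 0 ≤ 4 * ((u₁ : ℝ) + 1) * ((u₂ : ℝ) + 1) *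
      (((a : ℝ) + c + 1) * ∑ i ∈ range (h₁ + 1), ∑ j ∈ range (h₂ + 1),
        (h₁.choose i : ℝ) * (if i ≤ a + 1 then (u₁.choose (a + 1 - i) : ℝ) else 0) *
          ((h₂.choose j : ℝ) * (if j ≤ c + 1 then (u₂.choose (c + 1 - j) : ℝ) else 0)) * B (i + j) -
      ((a : ℝ) + c) * ∑ i ∈ range (h₁ + 1), ∑ j ∈ range (h₂ + 1),
        (h₁.choose i : ℝ) * (if i ≤ a + 1 then (u₁.choose (a + 1 - i) : ℝ) else 0) *
          ((h₂.choose j : ℝ) * (if j ≤ c then (u₂.choose (c - j) : ℝ) else 0)) * B (i + j))) hpos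
    linarith
  -- change of variables: hits drawn (i,j) ↦ unhits drawn (x,y) = (a+1-i, c+1-j)
  set w₁ : ℕ → ℝ := fun x => if x ≤ a + 1 then (h₁.choose (a + 1 - x) : ℝ) else 0 with hw₁def
  set w₂ : ℕ → ℝ := fun y => if y ≤ c + 1 then (h₂.choose (c + 1 - y) : ℝ) else 0 with hw₂def
  have hw₁ : ∀ x, w₁ x = if x ≤ a + 1 then (h₁.choose (a + 1 - x) : ℝ) else 0 := fun x => rfl
  have hw₂ : ∀ y, w₂ y = if y ≤ c + 1 then (h₂.choose (c + 1 - y) : ℝ) else 0 := fun y => rfl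
  have hw₁sym := CoreLemma.w_symm a h₁ u₁ hn₁ w₁ hw₁
  have hw₁uni := CoreLemma.w_uni a h₁ u₁ hn₁ w₁ hw₁
  have hw₁pos := CoreLemma.w_nonneg a h₁ w₁ hw₁
  have hw₂sym := CoreLemma.w_symm c h₂ u₂ hn₂ w₂ hw₂
  have hw₂uni := CoreLemma.w_uni c h₂ u₂ hn₂ w₂ hw₂
  have hw₂pos := CoreLemma.w_nonneg c h₂ w₂ hw₂
  -- the term in the unhit coordinates
  set V : ℕ → ℕ → ℝ := fun i j =>
    B (i + j) * (((u₁ : ℝ) + 1) * ((u₂ : ℝ) + 1) + (2 * ((a : ℝ) + c) + 1) * ((2 * (i : ℝ) - h₁) * (2 * (j : ℝ) - h₂)))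
    with hVdef
  have step1 : ∀ i ∈ range (h₁ + 1), ∑ j ∈ range (h₂ + 1),
      (h₁.choose i : ℝ) * (if i ≤ a + 1 then ((u₁ + 1).choose (a + 1 - i) : ℝ) else 0) *
        ((h₂.choose j : ℝ) * (if j ≤ c + 1 then ((u₂ + 1).choose (c + 1 - j) : ℝ) else 0)) * B (i + j) *
        (((u₁ : ℝ) + 1) * ((u₂ : ℝ) + 1) + (2 * ((a : ℝ) + c) + 1) * ((2 * (i : ℝ) - h₁) * (2 * (j : ℝ) - h₂))) =
      ∑ y ∈ range (u₂ + 1 + 1), ((u₂ + 1).choose y : ℝ) * (if y ≤ c + 1 then (h₂.choose (c + 1 - y) : ℝ) else 0) *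
        ((h₁.choose i : ℝ) * (if i ≤ a + 1 then ((u₁ + 1).choose (a + 1 - i) : ℝ) else 0) * V i (c + 1 - y)) := by
    intro i _
    rw [← reindex_block h₂ (c + 1) (u₂ + 1)
      (fun j => (h₁.choose i : ℝ) * (if i ≤ a + 1 then ((u₁ + 1).choose (a + 1 - i) : ℝ) else 0) * V i j)]
    refine sum_congr rfl fun j _ => ?_
    rw [hVdef]
    ring
  rw [sum_congr rfl step1, sum_comm]
  have step2 : ∀ y ∈ range (u₂ + 1 + 1), ∑ i ∈ range (h₁ + 1),
      ((u₂ + 1).choose y : ℝ) * (if y ≤ c + 1 then (h₂.choose (c + 1 - y) : ℝ) else 0) *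
        ((h₁.choose i : ℝ) * (if i ≤ a + 1 then ((u₁ + 1).choose (a + 1 - i) : ℝ) else 0) * V i (c + 1 - y)) =
      ∑ x ∈ range (u₁ + 1 + 1), ((u₁ + 1).choose x : ℝ) * (if x ≤ a + 1 then (h₁.choose (a + 1 - x) : ℝ) else 0) *
        (((u₂ + 1).choose y : ℝ) * (if y ≤ c + 1 then (h₂.choose (c + 1 - y) : ℝ) else 0) *
          V (a + 1 - x) (c + 1 - y)) := by
    intro y _
    rw [← reindex_block h₁ (a + 1) (u₁ + 1)
      (fun i => ((u₂ + 1).choose y : ℝ) * (if y ≤ c + 1 then (h₂.choose (c + 1 - y) : ℝ) else 0) *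
        V i (c + 1 - y))]
    refine sum_congr rfl fun i _ => ?_
    ring
  rw [sum_congr rfl step2, sum_comm]
  -- the two block-form sums Σ(ρ) and Σ(1/ρ)
  have hKN : 2 * (a + c + 1) = (u₁ + 1) + (u₂ + 1) + (h₁ + h₂ - 2) := by omega
  have hS1 := CoreRho.core_rho_pos (u₁ + 1) (u₂ + 1) (h₁ + h₂ - 2) (a + c + 1) hKN ρ hρ
    w₁ w₂ hw₁pos hw₁sym hw₁uni hw₂pos hw₂sym hw₂uni
  have hS2 := CoreRho.core_rho_pos (u₁ + 1) (u₂ + 1) (h₁ + h₂ - 2) (a + c + 1) hKN ρ⁻¹ (inv_pos.mpr hρ)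
    w₁ w₂ hw₁pos hw₁sym hw₁uni hw₂pos hw₂sym hw₂uni
  -- termwise: the (x,y) term equals ρ·[term of Σ(ρ)] + ρ·ρ^L·[term of Σ(1/ρ)]
  have hN : ((((u₁ + 1 + (u₂ + 1) + (h₁ + h₂ - 2) : ℕ)) : ℝ) - 1) = 2 * ((a : ℝ) + c) + 1 := by
    have : (((u₁ + 1 + (u₂ + 1) + (h₁ + h₂ - 2) : ℕ)) : ℝ) = ((2 * (a + c + 1) : ℕ) : ℝ) := by rw [hKN]
    rw [this]; push_cast; ring
  have key : ∀ x ∈ range (u₁ + 1 + 1), ∀ y ∈ range (u₂ + 1 + 1),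
      ((u₁ + 1).choose x : ℝ) * (if x ≤ a + 1 then (h₁.choose (a + 1 - x) : ℝ) else 0) *
        (((u₂ + 1).choose y : ℝ) * (if y ≤ c + 1 then (h₂.choose (c + 1 - y) : ℝ) else 0) *
          V (a + 1 - x) (c + 1 - y)) =
      ρ * (((u₁ + 1).choose x : ℝ) * w₁ x * (((u₂ + 1).choose y : ℝ) * w₂ y) *
          (if x + y ≤ a + c + 1 then ((h₁ + h₂ - 2).choose (a + c + 1 - (x + y)) : ℝ) *
            ρ ^ (a + c + 1 - (x + y)) else 0) *
          ((((u₁ + 1 : ℕ)) : ℝ) * (((u₂ + 1 : ℕ)) : ℝ) + ((((u₁ + 1 + (u₂ + 1) + (h₁ + h₂ - 2) : ℕ)) : ℝ) - 1) *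
            ((2 * (x : ℝ) - (((u₁ + 1 : ℕ)) : ℝ)) * (2 * (y : ℝ) - (((u₂ + 1 : ℕ)) : ℝ))))) +
      ρ * ρ ^ (h₁ + h₂ - 2) * (((u₁ + 1).choose x : ℝ) * w₁ x * (((u₂ + 1).choose y : ℝ) * w₂ y) *
          (if x + y ≤ a + c + 1 then ((h₁ + h₂ - 2).choose (a + c + 1 - (x + y)) : ℝ) *
            ρ⁻¹ ^ (a + c + 1 - (x + y)) else 0) *
          ((((u₁ + 1 : ℕ)) : ℝ) * (((u₂ + 1 : ℕ)) : ℝ) + ((((u₁ + 1 + (u₂ + 1) + (h₁ + h₂ - 2) : ℕ)) : ℝ) - 1) *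
            ((2 * (x : ℝ) - (((u₁ + 1 : ℕ)) : ℝ)) * (2 * (y : ℝ) - (((u₂ + 1 : ℕ)) : ℝ))))) := by
    intro x _ y _
    rw [hN, hw₁ x, hw₂ y]
    by_cases hx : x ≤ a + 1
    · by_cases hy : y ≤ c + 1
      · rw [if_pos hx, if_pos hy, hVdef]
        -- the bracket: (2(a+1-x) - h₁)(2(c+1-y) - h₂) = (2x - M₁)(2y - M₂)
        have hd : ((2 * (((a + 1 - x : ℕ)) : ℝ) - h₁) * (2 * (((c + 1 - y : ℕ)) : ℝ) - h₂)) =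
            ((2 * (x : ℝ) - (((u₁ + 1 : ℕ)) : ℝ)) * (2 * (y : ℝ) - (((u₂ + 1 : ℕ)) : ℝ))) := by
          have e1 : (h₁ : ℝ) + u₁ = 2 * a + 1 := by exact_mod_cast hn₁
          have e2 : (h₂ : ℝ) + u₂ = 2 * c + 1 := by exact_mod_cast hn₂
          push_cast [Nat.cast_sub hx, Nat.cast_sub hy]
          nlinarith [e1, e2]
        have hU : ((u₁ : ℝ) + 1) * ((u₂ : ℝ) + 1) = (((u₁ + 1 : ℕ)) : ℝ) * (((u₂ + 1 : ℕ)) : ℝ) := by push_cast; ring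
        simp only
        rw [hd, hU]
        -- the buffer
        by_cases hK : x + y ≤ a + c + 1
        · rw [if_pos hK, if_pos hK]
          have hij : a + 1 - x + (c + 1 - y) = (a + c + 1 - (x + y)) + 1 := by omega
          rw [hij]
          set z := a + c + 1 - (x + y) with hz
          rcases le_or_gt z (h₁ + h₂ - 2) with hzL | hzL
          · have hB1 : B (z + 1) = ((h₁ + h₂ - 2).choose z : ℝ) *
                (ρ ^ z * ρ + ρ ^ (h₁ + h₂ - 2) * (ρ ^ z)⁻¹ * ρ) := by
              show (if 1 ≤ z + 1 then ((h₁ + h₂ - 2).choose (z + 1 - 1) : ℝ) else 0) *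
                (ρ ^ (z + 1) + ρ ^ (h₁ + h₂ - (z + 1))) = _
              rw [if_pos (show 1 ≤ z + 1 by omega), Nat.add_sub_cancel,
                show h₁ + h₂ - (z + 1) = (h₁ + h₂ - 2 - z) + 1 by omega, pow_succ, pow_succ,
                pow_sub₀ ρ hρne hzL]
            rw [hB1, inv_pow]
            ring
          · have hC : ((h₁ + h₂ - 2).choose z : ℝ) = 0 := by exact_mod_cast Nat.choose_eq_zero_of_lt hzL
            have hB1 : B (z + 1) = 0 := by
              show (if 1 ≤ z + 1 then ((h₁ + h₂ - 2).choose (z + 1 - 1) : ℝ) else 0) *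
                (ρ ^ (z + 1) + ρ ^ (h₁ + h₂ - (z + 1))) = 0
              rw [if_pos (show 1 ≤ z + 1 by omega), Nat.add_sub_cancel, hC, zero_mul]
            rw [hB1, hC]
            ring
        · rw [if_neg hK, if_neg hK]
          have hij : a + 1 - x + (c + 1 - y) = 0 := by omega
          have hB0 : B 0 = 0 := by
            show (if 1 ≤ 0 then ((h₁ + h₂ - 2).choose (0 - 1) : ℝ) else 0) * (ρ ^ 0 + ρ ^ (h₁ + h₂ - 0)) = 0
            simp
          rw [hij, hB0]
          ring
      · rw [if_neg hy]
        simp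
    · rw [if_neg hx]
      simp
  rw [sum_congr rfl fun x hx => sum_congr rfl fun y hy => key x hx y hy]
  simp_rw [sum_add_distrib, ← mul_sum]
  exact add_nonneg (mul_nonneg hρ.le hS1) (mul_nonneg (by positivity) hS2)

end CoreT

end Summit.CriticalPhenomena.PercolationContinuityZ3.Theorems
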